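import Literature.AlgebraicGeometry.Morphisms.FormalModuleCompletion
import Literature.AlgebraicGeometry.Modules.IdealMul
import HarnessLib

/-!
# Formal modules modulo an ideal sheaf: `(F_n/𝒥F_n)_n` and `(M/𝒥M)^ = M^/𝒥`

Görtz–Wedhorn, *Algebraic Geometry II* (2023), §(24.18)–(24.21); The Stacks Project, Tag 088A
(the "tricky lemma" of Grothendieck's existence theorem works with the systems `(𝓕_n/𝒦𝓕_n)` and
`𝒦^e`-torsion systems). In the tree's QUOTIENT MODEL of coherent formal modules along `V(a)`
(`Morphisms/FormalModuleTower`, `…Completion`) and with the quotient functor `M ↦ M/𝒥M`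
(`Modules/IdealMul`: `idealQuotFunctor J`, right exact, commutes with multiplication by global
functions) this file proves:

* `IsFormalTower.comp_idealQuotFunctor` — **`(F_n/𝒥F_n)_n` is a formal tower** if `(F_n)_n` is
  (`−/𝒥` is right exact, so `F_n/𝒥F_n = (F_{n+1}/𝒥F_{n+1})/aⁿ⁺¹`);
* `idealQuotCmplObjIso`, **`idealQuotCmplTowerIso : cmplTower a M ⋙ (−/𝒥) ≅ cmplTower a (M/𝒥M)`**
  — "completion commutes with `−/𝒥`": `(M/aⁿ⁺¹M)/𝒥 ≅ (M/𝒥M)/aⁿ⁺¹`, compatibly with the projections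
  (`idealQuotMap_cmplπ_comp`, `idealQuotπ_cmplObj_comp`);
* `cmplMapApp_idealQuotπ_app_eq_zero_iff` — on an affine open `V`, the kernel of
  `(M/aⁿ⁺¹M)(V) → ((M/𝒥M)/aⁿ⁺¹)(V)` is `𝒥(V)·(M/aⁿ⁺¹M)(V)`;
* small transport lemmas for `IsKilledBy` (`isKilledBy_of_mono`, `isKilledBy_of_iso`; for sums of
  ideals see the tree's `IsKilledBy.sup` in `Morphisms/DevissageHeart`).

Everything is proved; no named facts.

## References

* The Stacks Project, Tag 088A (Cohomology of Schemes, Lemma 30.27.3), Tag 01CL. [StacksProject]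
* U. Görtz, T. Wedhorn, *Algebraic Geometry II: Cohomology of Schemes*, Springer Spektrum (2023),
  (24.18.1), Rem. 24.92 (pp. 562–565). [GortzWedhorn2023]
-/

noncomputable section

-- `TopCat.Presheaf`/`Scheme.Modules` are not reducible (as in Mathlib's `AlgebraicGeometry/Modules`).
set_option backward.isDefEq.respectTransparency false

open CategoryTheory AlgebraicGeometry Limits TopologicalSpace Opposite
open Literature.AlgebraicGeometry.Modules

universe u

namespace Literature.AlgebraicGeometry.Morphisms

variable {X : Scheme.{u}} (a : Γ(X, ⊤)) (J : X.IdealSheafData)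

/-! ### `IsKilledBy` transport -/

/-- A submodule of a module killed by `𝒥` is killed by `𝒥`. [folklore] -/
theorem isKilledBy_of_mono {J : X.IdealSheafData} {M N : X.Modules} (ι : M ⟶ N) [Mono ι]
    (hN : IsKilledBy J N) : IsKilledBy J M := by
  intro V r hr m
  apply KTheory.app_injective_of_mono ι V
  rw [Scheme.Modules.Hom.app_smul, map_zero]
  exact hN V r hr _

/-- `IsKilledBy` is invariant under isomorphism. [folklore] -/
theorem isKilledBy_of_iso {J : X.IdealSheafData} {M N : X.Modules} (e : M ≅ N) (hM : IsKilledBy J M) :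
    IsKilledBy J N :=
  IsKilledBy.of_epi e.hom hM

/-! ### `(F_n/𝒥F_n)_n` is a formal tower -/

section Tower

variable {a} {F : ℕᵒᵖ ⥤ X.Modules} (hF : IsFormalTower a F)
include hF

/-- `F_n` is the cokernel of `aⁿ⁺¹` on `F_{n+1}`, as an isomorphism `coker(aⁿ⁺¹) ≅ F_n` under `F_{n+1}`.
[cite: GortzWedhorn2023, (24.18.1) (p. 562)] -/
theorem IsFormalTower.exists_cokernelIso_towerπ (n : ℕ) :
    ∃ e : cokernel (globalScalar (F.obj ⟨n + 1⟩) (a ^ (n + 1))) ≅ F.obj ⟨n⟩,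
      cokernel.π _ ≫ e.hom = towerπ F n := by
  haveI := hF.epi n
  exact ⟨(cokernelIsCokernel _).coconePointUniqueUpToIso (hF.exact n).gIsCokernel,
    (cokernelIsCokernel _).comp_coconePointUniqueUpToIso_hom (hF.exact n).gIsCokernel
      WalkingParallelPair.one⟩

/-- **`(F_n/𝒥F_n)_n` is a formal tower** for a formal tower `(F_n)_n`: `−/𝒥` is right exact and
commutes with multiplication by `a`. [cite: StacksProject, Tag 088A] -/
theorem IsFormalTower.comp_idealQuotFunctor : IsFormalTower a (F ⋙ idealQuotFunctor J) where
  killed n := by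
    change globalScalar (idealQuot (F.obj ⟨n⟩) J) (a ^ (n + 1)) = 0
    rw [← idealQuotMap_globalScalar, hF.killed n, idealQuotMap_zero]
  epi n := by
    change Epi (idealQuotMap J (towerπ F n))
    haveI := hF.epi n
    exact epi_idealQuotMap J _
  exact n := by
    obtain ⟨e, he⟩ := hF.exists_cokernelIso_towerπ n
    -- `coker(aⁿ⁺¹ on F_{n+1}/𝒥) ≅ coker(aⁿ⁺¹/𝒥) ≅ (coker aⁿ⁺¹)/𝒥 ≅ F_n/𝒥`
    let e₃ : cokernel (globalScalar (idealQuot (F.obj ⟨n + 1⟩) J) (a ^ (n + 1))) ≅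
        idealQuot (F.obj ⟨n⟩) J :=
      cokernelIsoOfEq (idealQuotMap_globalScalar J (F.obj ⟨n + 1⟩) (a ^ (n + 1))).symm ≪≫
        idealQuotCokernelIso J (globalScalar (F.obj ⟨n + 1⟩) (a ^ (n + 1))) ≪≫
        (idealQuotFunctor J).mapIso e
    have he₃ : cokernel.π (globalScalar (idealQuot (F.obj ⟨n + 1⟩) J) (a ^ (n + 1))) ≫ e₃.hom =
        idealQuotMap J (towerπ F n) := by
      simp only [e₃, Iso.trans_hom, Functor.mapIso_hom, idealQuotFunctor_map]
      rw [π_comp_cokernelIsoOfEq_hom_assoc]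
      change cokernel.π _ ≫ idealQuotCokernelHom J _ ≫ idealQuotMap J e.hom = _
      rw [cokernel_π_idealQuotCokernelHom_assoc, ← idealQuotMap_comp, he]
    refine (ShortComplex.exact_iff_of_iso ?_).mp (ShortComplex.exact_cokernel
      (globalScalar (idealQuot (F.obj ⟨n + 1⟩) J) (a ^ (n + 1))))
    refine ShortComplex.isoMk (Iso.refl _) (Iso.refl _) e₃ ?_ ?_
    · simp only [Iso.refl_hom, Category.id_comp, Category.comp_id]
      rfl
    · simp only [Iso.refl_hom, Category.id_comp]
      exact he₃.symm

end Tower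

/-- The levels of `(F_n/𝒥F_n)_n` are coherent if those of `F` are (`X` locally noetherian). [folklore] -/
theorem coh_comp_idealQuotFunctor [IsLocallyNoetherian X] {F : ℕᵒᵖ ⥤ X.Modules}
    (hFc : ∀ n, Coh (F.obj ⟨n⟩)) (n : ℕ) : Coh ((F ⋙ idealQuotFunctor J).obj ⟨n⟩) :=
  coh_idealQuot J (hFc n)

/-- The levels of `(F_n/𝒥F_n)_n` are killed by `𝒥`. [folklore] -/
theorem isKilledBy_comp_idealQuotFunctor (F : ℕᵒᵖ ⥤ X.Modules) (n : ℕ) :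
    IsKilledBy J ((F ⋙ idealQuotFunctor J).obj ⟨n⟩) :=
  isKilledBy_idealQuot _ J

/-! ### Completion commutes with `−/𝒥` -/

section Cmpl

variable (M : X.Modules)

/-- **`(M/aⁿ⁺¹M)/𝒥 ≅ (M/𝒥M)/aⁿ⁺¹(M/𝒥M)`.** [cite: StacksProject, Tag 088A] -/
def idealQuotCmplObjIso (n : ℕ) : idealQuot (cmplObj a M n) J ≅ cmplObj a (idealQuot M J) n :=
  (idealQuotCokernelIso J (globalScalar M (a ^ (n + 1)))).symm ≪≫
    cokernelIsoOfEq (idealQuotMap_globalScalar J M (a ^ (n + 1)))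

/-- `(M → M/aⁿ⁺¹M)/𝒥 ≫ ≅ = (M/𝒥M → (M/𝒥M)/aⁿ⁺¹)`. [folklore] -/
@[reassoc]
theorem idealQuotMap_cmplπ_comp (n : ℕ) :
    idealQuotMap J (cmplπ a M n) ≫ (idealQuotCmplObjIso a J M n).hom = cmplπ a (idealQuot M J) n := by
  rw [idealQuotCmplObjIso, Iso.trans_hom, Iso.symm_hom, ← Category.assoc,
    (Iso.comp_inv_eq _).mpr (cokernel_π_idealQuotCokernelHom J (globalScalar M (a ^ (n + 1)))).symm]
  exact π_comp_cokernelIsoOfEq_hom _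

/-- `(M/aⁿ⁺¹M → (M/aⁿ⁺¹M)/𝒥) ≫ ≅` is the completion at level `n` of `M → M/𝒥M`. [folklore] -/
@[reassoc]
theorem idealQuotπ_cmplObj_comp (n : ℕ) :
    idealQuotπ (cmplObj a M n) J ≫ (idealQuotCmplObjIso a J M n).hom =
      cmplMapApp a (idealQuotπ M J) n := by
  rw [← cancel_epi (cmplπ a M n), ← Category.assoc, ← idealQuotπ_idealQuotMap, Category.assoc,
    idealQuotMap_cmplπ_comp, cmplπ_cmplMapApp]

/-- `idealQuotMap` of the (epi) projection `M → M/aⁿ⁺¹M` is an epimorphism. [folklore] -/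
instance epi_idealQuotMap_cmplπ (n : ℕ) : Epi (idealQuotMap J (cmplπ a M n)) :=
  epi_idealQuotMap J _

/-- Compatibility with the transition maps. [folklore] -/
@[reassoc]
theorem idealQuotMap_cmplStep_comp (n : ℕ) :
    idealQuotMap J (cmplStep a M n) ≫ (idealQuotCmplObjIso a J M n).hom =
      (idealQuotCmplObjIso a J M (n + 1)).hom ≫ cmplStep a (idealQuot M J) n := by
  rw [← cancel_epi (idealQuotMap J (cmplπ a M (n + 1))), ← Category.assoc, ← idealQuotMap_comp,
    cmplπ_cmplStep, idealQuotMap_cmplπ_comp, idealQuotMap_cmplπ_comp_assoc, cmplπ_cmplStep]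

/-- **`(M^)/𝒥 ≅ (M/𝒥M)^`**: the quotient modulo `𝒥` of the completion tower of `M` is the completion
tower of `M/𝒥M`. [cite: StacksProject, Tag 088A] -/
def idealQuotCmplTowerHom :
    cmplTower a M ⋙ idealQuotFunctor J ⟶ cmplTower a (idealQuot M J) :=
  NatTrans.ofOpSequence (fun n => (idealQuotCmplObjIso a J M n).hom) fun n => by
    change idealQuotMap J (towerπ (cmplTower a M) n) ≫ (idealQuotCmplObjIso a J M n).hom =
      (idealQuotCmplObjIso a J M (n + 1)).hom ≫ towerπ (cmplTower a _) n
    rw [towerπ_cmplTower, towerπ_cmplTower]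
    exact idealQuotMap_cmplStep_comp a J M n

/-- Components of `idealQuotCmplTowerHom`. [folklore] -/
@[simp]
theorem idealQuotCmplTowerHom_app (n : ℕ) :
    (idealQuotCmplTowerHom a J M).app ⟨n⟩ = (idealQuotCmplObjIso a J M n).hom := rfl

/-- `idealQuotCmplTowerHom` is an isomorphism. [folklore] -/
instance isIso_idealQuotCmplTowerHom : IsIso (idealQuotCmplTowerHom a J M) := by
  haveI : ∀ k : ℕᵒᵖ, IsIso ((idealQuotCmplTowerHom a J M).app k) := fun ⟨n⟩ => by
    rw [idealQuotCmplTowerHom_app]; infer_instance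
  exact NatIso.isIso_of_isIso_app _

/-- **`(M^)/𝒥 ≅ (M/𝒥M)^`** as an isomorphism of towers. [cite: StacksProject, Tag 088A] -/
def idealQuotCmplTowerIso : cmplTower a M ⋙ idealQuotFunctor J ≅ cmplTower a (idealQuot M J) :=
  asIso (idealQuotCmplTowerHom a J M)

/-- Components of `idealQuotCmplTowerIso`. [folklore] -/
@[simp]
theorem idealQuotCmplTowerIso_hom_app (n : ℕ) :
    (idealQuotCmplTowerIso a J M).hom.app ⟨n⟩ = (idealQuotCmplObjIso a J M n).hom := rfl

/-- **The kernel of `(M/aⁿ⁺¹M)(V) → ((M/𝒥M)/aⁿ⁺¹)(V)` on an affine `V` is `𝒥(V)·(M/aⁿ⁺¹M)(V)`**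
(for `M/aⁿ⁺¹M` affine-localizing). [cite: StacksProject, Tag 088A] -/
theorem cmplMapApp_idealQuotπ_app_eq_zero_iff (n : ℕ) (hM : IsAffineLocalizing (cmplObj a M n))
    {V : X.Opens} (hV : IsAffineOpen V) (x : Γ(cmplObj a M n, V)) :
    (cmplMapApp a (idealQuotπ M J) n).app V x = 0 ↔
      x ∈ J.ideal ⟨V, hV⟩ • (⊤ : Submodule Γ(X, V) Γ(cmplObj a M n, V)) := by
  rw [← idealQuotπ_app_eq_zero_iff J hM hV x, ← idealQuotπ_cmplObj_comp]
  change ((idealQuotCmplObjIso a J M n).hom.app V) ((idealQuotπ (cmplObj a M n) J).app V x) = 0 ↔ _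
  constructor
  · intro h
    have h' := congrArg ((idealQuotCmplObjIso a J M n).inv.app V) h
    rw [map_zero] at h'
    change ((idealQuotCmplObjIso a J M n).hom ≫ (idealQuotCmplObjIso a J M n).inv).app V _ = 0 at h'
    rw [Iso.hom_inv_id] at h'
    exact h'
  · intro h
    rw [h, map_zero]

end Cmpl

end Literature.AlgebraicGeometry.Morphisms

end
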